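import Summits.CriticalPhenomena.Ising3DConformalLimit.Theses.CanonicalBranchRefutation
import Literature.Probability.LatticeModels.CriticalUrsellFourSign
import Summits.CriticalPhenomena.Ising3DConformalLimit.Theorems.MoebiusLimitExists.Negative.InversionContent
import Summits.CriticalPhenomena.Ising3DConformalLimit.Theorems.CanonicalBranchRefutationIsingLimitHeritageBondMirrorRP
import Summits.CriticalPhenomena.Ising3DConformalLimit.Theorems.CanonicalBranchRefutationIsingLimitHeritageRpAlongOfLatticeBondRP
import Summits.CriticalPhenomena.Ising3DConformalLimit.Theorems.CanonicalBranchRefutationIsingLimitHeritageGksCrossPairings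
import HarnessLib

/-!
# Crux `CanonicalBranchRefutation.IsingLimitHeritage` (stmt-CriticalPhenomena-15523) — proved

Every pointwise scaling limit `S` of the critical `ℤ³` Ising correlators `criticalCorr 3`
(renormalisation `ρ > 0` on `(0,1]` — the positivity is part of the crux statement but is not used)
inherits

* (a) Osterwalder–Schrader reflection positivity along each coordinate axis in the POINTWISE sense
  `IsReflectionPositiveAlong τ S` (Glimm–Jaffe 1987, §6.1 (OS3), on half-space point
  configurations): bond-plane reflection positivity of the critical state
  (`stub_bondMirrorRP`, FILS 1978 §2 through bonds + the box limit at `m*(β_c) = 0`) is transported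
  to the limit WITHOUT any continuity of `S` by the exact bond-mirror equivariance of the floor map
  on generic meshes (`stub_rpAlong_of_latticeBondRP`);
* (b) GKS II for the three pairings of a non-coincident quadruple (pairing `(01|23)` is the tree's
  `MoebiusLimitExistsNegative.limit_four_ge_two_mul_two`, the cross pairings are
  `stub_gksCrossPairings`, Friedli–Velenik 2017 Thm. 3.20 (3.22) in the limit);
* (c) Lebowitz' inequality `U₄ ≤ 0` in the limit (the Literature theorem
  `limitConnectedFour_nonpos_of_hasPointwiseScalingLimit`).

This is the registered birth skeleton of line `registered` (`Cruxes/IsingLimitHeritage/Lines/birth.lean`)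
with its three stubs landed as
`Theorems/CanonicalBranchRefutationIsingLimitHeritage{BondMirrorRP,RpAlongOfLatticeBondRP,GksCrossPairings}.lean`;
the composition below is the skeleton's `IsingLimitHeritage_of` / `IsingLimitHeritage_of_stubs`, now
`sorry`-free.

References: J. Fröhlich, R. Israel, E. H. Lieb, B. Simon, Comm. Math. Phys. 62 (1978) 1–34, §2;
J. Glimm, A. Jaffe, *Quantum Physics* (2nd ed. 1987), §6.1; S. Friedli, Y. Velenik, *Statistical
Mechanics of Lattice Systems* (CUP 2017), Lemma 10.8, Thm. 3.20; J. L. Lebowitz, Comm. Math. Phys. 35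
(1974) 87–92. No definitions are introduced.
-/

namespace Summit.CriticalPhenomena.Ising3DConformalLimit.Cruxes.IsingLimitHeritage.Birth

open Literature.Probability.LatticeModels Literature.MathematicalPhysics.QuantumFieldTheory
open Summit.CriticalPhenomena.Ising3DConformalLimit.Theses.CanonicalBranchRefutation

/-- **The line closes the crux** (composition of the birth skeleton, hypotheses spelled out):
bond-mirror lattice RP transported to the limit (second hypothesis at `G := criticalCorr 3`, fed by
the first), GKS II for the three pairings (tree `limit_four_ge_two_mul_two` + third hypothesis) and
Lebowitz in the limit (Literature `limitConnectedFour_nonpos_of_hasPointwiseScalingLimit`). -/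
theorem IsingLimitHeritage_of
    (hRP : ∀ (τ : Fin 3) (m : ℕ) (k : Fin m → ℕ) (z : (a : Fin m) → Fin (k a) → Site 3)
        (c : Fin m → ℝ), (∀ a i, 0 ≤ z a i τ) →
      0 ≤ ∑ a, ∑ b, c a * c b *
        criticalCorr 3 (k a + k b)
          (Fin.append (fun i => Function.update (z a i) τ (-1 - z a i τ)) (z b)))
    (hT : ∀ (τ : Fin 3) (G : LatticeCorrFamily 3) (ρ : ℝ → ℝ) (S : CorrFamily 3),
      (∀ (m : ℕ) (k : Fin m → ℕ) (z : (a : Fin m) → Fin (k a) → Site 3) (c : Fin m → ℝ),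
        (∀ a i, 0 ≤ z a i τ) →
        0 ≤ ∑ a, ∑ b, c a * c b *
          G (k a + k b) (Fin.append (fun i => Function.update (z a i) τ (-1 - z a i τ)) (z b))) →
      HasPointwiseScalingLimit G ρ S → IsReflectionPositiveAlong τ S)
    (hG : ∀ (ρ : ℝ → ℝ) (S : CorrFamily 3), HasPointwiseScalingLimit (criticalCorr 3) ρ S →
      ∀ x ∈ NonCoincident 3 4,
        S 2 ![x 0, x 2] * S 2 ![x 1, x 3] ≤ S 4 x ∧ S 2 ![x 0, x 3] * S 2 ![x 1, x 2] ≤ S 4 x) :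
    IsingLimitHeritage := by
  intro ρ S _hρ hlim
  refine ⟨fun τ => hT τ (criticalCorr 3) ρ S (hRP τ) hlim, fun x hx => ?_, fun x hx =>
    limitConnectedFour_nonpos_of_hasPointwiseScalingLimit (d := 3) le_rfl hlim hx⟩
  obtain ⟨h02, h03⟩ := hG ρ S hlim x hx
  exact ⟨MoebiusLimitExistsNegative.limit_four_ge_two_mul_two hlim hx, h02, h03⟩

/-- **Crux `IsingLimitHeritage` (stmt-CriticalPhenomena-15523), proved**: every pointwise scaling
limit of the critical `ℤ³` Ising correlators inherits (a) pointwise OS reflection positivity along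
the three axes, (b) GKS II for the three pairings, (c) Lebowitz `U₄ ≤ 0` — the three landed stubs
`stub_bondMirrorRP`, `stub_rpAlong_of_latticeBondRP`, `stub_gksCrossPairings` discharge the
hypotheses of `IsingLimitHeritage_of` verbatim. -/
theorem IsingLimitHeritage_of_stubs : IsingLimitHeritage :=
  IsingLimitHeritage_of stub_bondMirrorRP stub_rpAlong_of_latticeBondRP stub_gksCrossPairings

end Summit.CriticalPhenomena.Ising3DConformalLimit.Cruxes.IsingLimitHeritage.Birth
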